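import Literature.AlgebraicGeometry.ShimuraVarieties.HeckeCorrespondenceAction
import Literature.AlgebraicGeometry.HodgeTheory.RationalHodgeClasses
import Literature.AlgebraicGeometry.HodgeTheory.ComplexConjugationHolds
import Literature.AlgebraicGeometry.Motives.AlgPointsProductProofs
import Literature.Geometry.Kaehler.AnalyticSetBiholomorph
import Mathlib.Topology.Algebra.ConstMulAction
import Mathlib.Geometry.Manifold.IsManifold.Basic

/-!
# The Hecke graph is analytic of codimension `dim X` in ANY Hodge model of `X ⊗ X`
# (S2b assembly, part 2; crux `EndoscopicMiddleDegree.OrthogonalEnveloped`, stmt-HodgeConjecture-14300, lead seat c3)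

`stub_heckeGraphAnalyticOfStubs`: the registered construction stub `stub_heckeGraphAnalytic` (S2b) of the
line `purity-sorted-hecke-envelope` — for an admissible `g`, the image of the topological Hecke graph
`ℓ ↦ (π ℓ, π_g ℓ)`, pulled back to the carrier of an ARBITRARY Hodge model `A` of `X ⊗ X`, is a closed analytic
subset all of whose regular points have codimension `≥ 2(m+1) = dim X` — follows from: (i) the same
statement in the square `A_X.carrier × A_X.carrier` of a Hodge model of `X` (part 1,
`stub_heckeImageModelAnalytic`, itself from the sub-stubs B/A1/A2/C/D); (ii) the comparison
biholomorphism `A.carrier ≃ A_X.carrier × A_X.carrier` over `(X ⊗ X)(ℂ) ≃ X(ℂ) × X(ℂ)` (sub-stub E2 with O,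
`stub_hodgeModelProdBiholomorph`, landed p110858 / p110775); (iii) `Γ` properly discontinuous and free on the
locally compact Hausdorff ball (G1 `stub_properlyDiscontinuous`; `stub_freeOfProperlyDiscontinuous` p107635,
`stub_ballLocallyCompactT2` p107937) — all as verbatim hypotheses (the farm does not yet serve the landed
modules; the composition is a one-liner filed separately). Transport: analyticity pulls back along the
holomorphic comparison map (`IsAnalyticSet.preimage`) and lower bounds on the codimension at regular points
are invariant under biholomorphisms (`forall_regularLocus_preimage_le`); `dim A_X.model = 2(m+1)`
(`IsAnalytification.finrank_eq`).

References: BMM arXiv:1306.1515 Part 2 §1.8; Shimura 1971 Ch. 7 §7.2; Serre GAGA §2 n°5; Chirka §2.3.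
-/

noncomputable section

-- The crux-workfile namespace `Summit.<P>.<Sub>.Cruxes.…` repeats `HodgeConjecture` (single-conjunct summit).
set_option linter.dupNamespace false

namespace Summit.HodgeConjecture.HodgeConjecture.Cruxes.OrthogonalEnveloped.HeckeGraphChow

open scoped Manifold ContDiff Topology
open Set
open CategoryTheory MonoidalCategory CartesianMonoidalCategory
open Literature.AlgebraicGeometry.Motives (SchemeOver ComplexPoints IsSmoothProjective AlgPoints)
open Literature.AlgebraicGeometry.HodgeTheory (HodgeModel nonempty_hodgeModel_holds)
open Literature.AlgebraicGeometry.ShimuraVarieties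
open Literature.Geometry.Kaehler

variable {m : ℕ} {X : SchemeOver ℂ}

/-- The Hecke image in the complex points, pulled back to a Hodge model `A` of `X ⊗ X`, is the preimage
under a comparison map `e : A.carrier → A_X.carrier × A_X.carrier` over `(X ⊗ X)(ℂ) ≃ X(ℂ) × X(ℂ)` of the
model image `{(a, b) | ∃ ℓ, π ℓ = φ a ∧ π_g ℓ = φ b}`. [folklore] -/
theorem preimage_range_heckeGraph_eq (D : UnitaryBallQuotientDatum (2 * (m + 1)) X)
    {g : GL (Fin (2 * (m + 1) + 1)) D.E} (h : D.IsHeckeAdmissible g)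
    (AX : HodgeModel (2 * (m + 1)) X) (A : HodgeModel (2 * (m + 1) + 2 * (m + 1)) (X ⊗ X))
    (e : A.carrier ≃ₜ AX.carrier × AX.carrier)
    (hcomm : ∀ b, (AX.toComplexPoints (e b).1, AX.toComplexPoints (e b).2) =
      AlgPoints.prodEquiv (A.toComplexPoints b)) :
    A.toComplexPoints ⁻¹' Set.range (fun ℓ : D.LevelCover (D.heckeLevel g) ↦
        (AlgPoints.prodEquiv (X := X) (Y := X) (L := ℂ)).symm
          (D.levelProj (D.heckeLevel g) ℓ, UnitaryBallQuotientDatum.IsHeckeAdmissible.twist D h ℓ)) =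
      e ⁻¹' {z : AX.carrier × AX.carrier | ∃ ℓ : D.LevelCover (D.heckeLevel g),
          D.levelProj (D.heckeLevel g) ℓ = AX.toComplexPoints z.1 ∧
            UnitaryBallQuotientDatum.IsHeckeAdmissible.twist D h ℓ = AX.toComplexPoints z.2} := by
  ext a
  simp only [mem_preimage, mem_range, mem_setOf_eq]
  constructor
  · rintro ⟨ℓ, hℓ⟩
    have key := congrArg (AlgPoints.prodEquiv (X := X) (Y := X) (L := ℂ)) hℓ
    rw [Equiv.apply_symm_apply, ← hcomm] at key
    exact ⟨ℓ, (Prod.ext_iff.1 key).1, (Prod.ext_iff.1 key).2⟩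
  · rintro ⟨ℓ, h1, h2⟩
    refine ⟨ℓ, ?_⟩
    rw [Equiv.symm_apply_eq, ← hcomm]
    exact Prod.ext h1 h2

/-- **S2b from the sub-stubs (REGISTERED composition stub `stub_heckeGraphAnalyticOfStubs`).** Granted (i) the
model statement (part 1: the Hecke image in the square of a Hodge model of `X` is analytic with regular points
of codimension `dim X`), (ii) the comparison biholomorphism of a Hodge model of `X ⊗ X` with that square (E2+O),
and (iii) proper discontinuity, freeness and the topology of the ball (G1 + landed consequences), the Hecke
graph of every admissible `g` read in ANY Hodge model of `X ⊗ X` is a closed analytic subset all of whose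
regular points have codimension `≥ 2(m+1)` — byte-identical with the conclusion of `stub_heckeGraphAnalytic`.
[cite: BergeronMillsonMoeglin2016Balls, Part 2 §1.8] [cite: Shimura1973, Ch. 7 §7.2] -/
theorem stub_heckeGraphAnalyticOfStubs :
    (∀ {p : ℕ} {X : SchemeOver ℂ} (D : UnitaryBallQuotientDatum p X)
      [ProperlyDiscontinuousSMul ↥D.Γ D.ball] [IsCancelSMul ↥D.Γ D.ball]
      [LocallyCompactSpace D.ball] [T2Space D.ball] (A : HodgeModel p X) {g : GL (Fin (p + 1)) D.E}
      (h : D.IsHeckeAdmissible g),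
      IsAnalyticSet (𝓘(ℂ, A.model).prod 𝓘(ℂ, A.model))
        {z : A.carrier × A.carrier | ∃ ℓ : D.LevelCover (D.heckeLevel g),
          D.levelProj (D.heckeLevel g) ℓ = A.toComplexPoints z.1 ∧
            UnitaryBallQuotientDatum.IsHeckeAdmissible.twist D h ℓ = A.toComplexPoints z.2} ∧
      ∀ x ∈ regularLocus (𝓘(ℂ, A.model).prod 𝓘(ℂ, A.model))
        {z : A.carrier × A.carrier | ∃ ℓ : D.LevelCover (D.heckeLevel g),
          D.levelProj (D.heckeLevel g) ℓ = A.toComplexPoints z.1 ∧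
            UnitaryBallQuotientDatum.IsHeckeAdmissible.twist D h ℓ = A.toComplexPoints z.2}, ∀ q : ℕ,
        IsRegularPointOfCodim (𝓘(ℂ, A.model).prod 𝓘(ℂ, A.model))
          {z : A.carrier × A.carrier | ∃ ℓ : D.LevelCover (D.heckeLevel g),
          D.levelProj (D.heckeLevel g) ℓ = A.toComplexPoints z.1 ∧
            UnitaryBallQuotientDatum.IsHeckeAdmissible.twist D h ℓ = A.toComplexPoints z.2} q x →
          Module.finrank ℂ A.model ≤ q) →
    (∀ {n : ℕ} {X : SchemeOver ℂ} (_hX : IsSmoothProjective n X) (A : HodgeModel n X)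
      (B : HodgeModel (n + n) (X ⊗ X)),
      ∃ h : B.carrier ≃ₜ A.carrier × A.carrier,
        MDifferentiable 𝓘(ℂ, B.model) (𝓘(ℂ, A.model).prod 𝓘(ℂ, A.model)) h ∧
        MDifferentiable (𝓘(ℂ, A.model).prod 𝓘(ℂ, A.model)) 𝓘(ℂ, B.model) h.symm ∧
        ∀ b, (A.toComplexPoints (h b).1, A.toComplexPoints (h b).2) =
          AlgPoints.prodEquiv (B.toComplexPoints b)) →
    (∀ {p : ℕ} {X : SchemeOver ℂ} (D : UnitaryBallQuotientDatum p X),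
      ProperlyDiscontinuousSMul ↥D.Γ D.ball) →
    (∀ {p : ℕ} {X : SchemeOver ℂ} (D : UnitaryBallQuotientDatum p X)
      [ProperlyDiscontinuousSMul ↥D.Γ D.ball], IsCancelSMul ↥D.Γ D.ball) →
    (∀ {p : ℕ} {X : SchemeOver ℂ} (D : UnitaryBallQuotientDatum p X),
      LocallyCompactSpace D.ball ∧ T2Space D.ball) →
    ∀ (m : ℕ) (X : SchemeOver ℂ) (D : UnitaryBallQuotientDatum (2 * (m + 1)) X), 1 ≤ m → m ≤ 2 →
      ∀ (g : GL (Fin (2 * (m + 1) + 1)) D.E) (h : D.IsHeckeAdmissible g)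
        (A : HodgeModel (2 * (m + 1) + 2 * (m + 1)) (X ⊗ X)),
        IsAnalyticSet 𝓘(ℂ, A.model)
            (A.toComplexPoints ⁻¹' Set.range (fun ℓ : D.LevelCover (D.heckeLevel g) ↦
              (AlgPoints.prodEquiv (X := X) (Y := X) (L := ℂ)).symm
                (D.levelProj (D.heckeLevel g) ℓ, UnitaryBallQuotientDatum.IsHeckeAdmissible.twist D h ℓ))) ∧
          ∀ x ∈ regularLocus 𝓘(ℂ, A.model)
              (A.toComplexPoints ⁻¹' Set.range (fun ℓ : D.LevelCover (D.heckeLevel g) ↦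
                (AlgPoints.prodEquiv (X := X) (Y := X) (L := ℂ)).symm
                  (D.levelProj (D.heckeLevel g) ℓ, UnitaryBallQuotientDatum.IsHeckeAdmissible.twist D h ℓ))),
            ∀ q : ℕ, IsRegularPointOfCodim 𝓘(ℂ, A.model)
              (A.toComplexPoints ⁻¹' Set.range (fun ℓ : D.LevelCover (D.heckeLevel g) ↦
                (AlgPoints.prodEquiv (X := X) (Y := X) (L := ℂ)).symm
                  (D.levelProj (D.heckeLevel g) ℓ, UnitaryBallQuotientDatum.IsHeckeAdmissible.twist D h ℓ))) q x →
              2 * (m + 1) ≤ q := by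
  intro hModel hE2 hG1 hFree hBall m X D _ _ g h A
  haveI : ProperlyDiscontinuousSMul ↥D.Γ D.ball := hG1 D
  haveI : IsCancelSMul ↥D.Γ D.ball := hFree D
  obtain ⟨hLC, hT2⟩ := hBall D
  haveI := hLC
  haveI := hT2
  obtain ⟨AX⟩ := nonempty_hodgeModel_holds.nonempty D.isSmoothProjective
  obtain ⟨e, he, he', hcomm⟩ := hE2 D.isSmoothProjective AX A
  obtain ⟨hS, hSreg⟩ := hModel D AX h
  rw [preimage_range_heckeGraph_eq D h AX A e hcomm]
  refine ⟨hS.preimage he, fun x hx q hq ↦ ?_⟩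
  have key := forall_regularLocus_preimage_le e he he' hSreg x hx q hq
  rwa [AX.isAnalytification.finrank_eq] at key

end Summit.HodgeConjecture.HodgeConjecture.Cruxes.OrthogonalEnveloped.HeckeGraphChow

end
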